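import Literature.Probability.RandomPlanarGeometry.WholePlaneSLEKappaRhoExistenceChordal
import Literature.Probability.RandomPlanarGeometry.LocalMartingaleProofs
import Literature.Probability.RandomPlanarGeometry.SLETraceApproximation
import HarnessLib

/-!
# Whole-plane SLE_κ(ρ) exists given `hasSLETrace_eight` — transport of the canonical SLE trace theorem to every Brownian motion

Topic `Probability/RandomPlanarGeometry`; theorems only (no definition, no named fact).

The whole-plane pipeline of `WholePlaneSLEKappaRhoExistenceChordal` closes the named fact
`IsWholePlaneSLEKappaRho.exists` (Miller–Sheffield (2013), Prop. 2.5) from the chordal input at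
`κ = 8` in GENERAL-Brownian-motion form ("for every real Brownian motion `B'` on every probability
space, almost surely the chordal Loewner chain driven by `√8 B'` is generated by a curve"), whereas
the tree's named fact `hasSLETrace_eight` (Lawler–Schramm–Werner (2004), Thm. 4.7) is the
CANONICAL-space statement `HasSLETrace 8` (for `preWienerMeasure`-a.e. `ω`, the chain of
`sleDriving 8 ω = √8 · brownian · ω` is generated by a curve). This file supplies the transport
between the two forms, in the direction canonical → general (the direction general → canonical is
the tree's `hasSLETrace_of_isBrownianReal`, `SLELawOfDrivingProcessLocal.lean`):

* `HasSLETrace.ae_exists_isGeneratedByCurve` — **if SLE_κ on the canonical space is a.s. generated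
  by a curve, then so is the chain driven by `√κ B'` for ANY Brownian motion `B'` with measurable
  marginals and continuous paths on ANY measurable space.** Proof: the random continuous path
  `√κ B' ∈ C([0, ∞), ℝ)` has the law of the canonical SLE_κ driving path
  (`map_eq_map_drivingPath`, the canonical Brownian motion existing by
  `exists_isBrownianReal_measurable_continuous_holds`), and the set of continuous driving paths
  whose chain is generated by a curve is Borel (`measurableSet_snd_image_generatedPairs`,
  Lusin–Souslin), so "almost surely in that set" passes from one process to the other through the
  common law (`ae_map_iff`). This is the routine "the statement only depends on the law of the
  driving process" step (Lawler (2005), §6.1: SLE_κ is defined for "a standard Brownian motion";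
  Rohde–Schramm (2005), Thm. 5.1 is stated for "Brownian motion").
* `HasSLETrace.ae_exists_isGeneratedByCurve'` — the same with the a.s.-continuity of paths packaged
  in Mathlib's `IsBrownianReal` replaced by everywhere-continuity plus measurable marginals, in the
  exact binder shape of the chordal input `hgen8` of
  `IsWholePlaneSLEKappaRho.exists_of_chordal_eight`.
* `hasSLETrace_iff_forall_isBrownianReal` — the two forms are equivalent.
* `IsWholePlaneSLEKappaRho.exists_of_hasSLETrace_eight` — **the named fact
  `IsWholePlaneSLEKappaRho.exists` (all `0 < κ ≤ 2(ρ + 2)`) from the single named fact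
  `hasSLETrace_eight`**: `κ ≠ 8` unconditionally (`IsWholePlaneSLEKappaRho.exists_ne_eight`,
  Rohde–Schramm), `κ = 8` through the transport and `exists_of_chordal_eight`.

Hence the discharge `IsWholePlaneSLEKappaRho.exists_holds` is
`IsWholePlaneSLEKappaRho.exists_of_hasSLETrace_eight hasSLETrace_eight_holds` as soon as
Lawler–Schramm–Werner's Thm. 4.7 is discharged on the canonical space (its tenure files
`SLETraceEight*.lean` reduce it to the uniform-spanning-tree inputs Prop. 4.5 and Thm. 4.4 of
[LSW04]).

## References

* J. Miller, S. Sheffield, *Imaginary geometry IV: interior rays, whole-plane reversibility, and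
  space-filling trees*, PTRF 169 (2017), arXiv:1302.4738, Prop. 2.5. [MillerSheffield2013]
* G. F. Lawler, O. Schramm, W. Werner, *Conformal invariance of planar loop-erased random walks
  and uniform spanning trees*, Ann. Probab. 32 (2004), Thm. 4.7. [LawlerSchrammWerner2004]
* S. Rohde, O. Schramm, *Basic properties of SLE*, Ann. of Math. 161 (2005), Thm. 5.1.
  [RohdeSchramm2005]
* G. F. Lawler, *Conformally Invariant Processes in the Plane*, AMS (2005), §6.1. [Lawler2005]
* A. S. Kechris, *Classical Descriptive Set Theory* (1995), Thm. 15.1 (Lusin–Souslin).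
-/

noncomputable section

open MeasureTheory ProbabilityTheory Filter Topology Set
open scoped NNReal ENNReal

namespace Literature.Probability.RandomPlanarGeometry

open scoped PathBorel

/-! ### Transport of the canonical trace theorem to every Brownian motion -/

/-- **The SLE_κ trace theorem for every Brownian motion, from its canonical-space form.** If SLE_κ
on the canonical space is almost surely generated by a curve (`HasSLETrace κ`), then for every
Brownian motion `B'` (Mathlib `IsBrownianReal`) with measurable marginals and everywhere
continuous paths on any measurable space `(Ω', P')`, almost surely the chordal Loewner chain
driven by `t ↦ √κ B'ₜ` is generated by a curve. The law of `√κ B' ∈ C([0, ∞), ℝ)` is the law of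
the canonical driving path (`map_eq_map_drivingPath`) and the set of driving paths generated by a
curve is Borel (`measurableSet_snd_image_generatedPairs`). Lawler (2005), §6.1 with
Rohde–Schramm (2005), Thm. 5.1 / Lawler–Schramm–Werner (2004), Thm. 4.7.
[cite: Lawler2005, §6.1] -/
theorem HasSLETrace.ae_exists_isGeneratedByCurve {κ : ℝ≥0} (hκt : HasSLETrace κ)
    {Ω' : Type*} [MeasurableSpace Ω'] {P' : Measure Ω'} {B' : ℝ≥0 → Ω' → ℝ}
    (hBM : IsBrownianReal B' P') (hm : ∀ t, Measurable (B' t)) (hc : ∀ ω, Continuous (B' · ω)) :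
    ∀ᵐ ω ∂P', ∃ γ : ℝ≥0 → ℂ, Loewner.IsGeneratedByCurve (fun t ↦ Real.sqrt κ * B' t ω) γ := by
  -- `√κ B'`, as a random continuous path, has the law of the SLE_κ driving path
  set Φ : Ω' → C(ℝ≥0, ℝ) :=
    fun ω ↦ ⟨fun t ↦ Real.sqrt κ * B' t ω, continuous_const.mul (hc ω)⟩ with hΦdef
  have hΦm : Measurable Φ :=
    Process.measurable_continuousMap_of_eval fun t ↦ (hm t).const_mul _
  have hlaw : P'.map Φ = Process.preWienerMeasure.map (drivingPath κ) :=
    map_eq_map_drivingPath κ exists_isBrownianReal_measurable_continuous_holds hBM hc hm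
  -- on the canonical space, the driving path lies a.s. in the Borel set of generated paths
  have hG : ∀ᵐ ω ∂Process.preWienerMeasure, drivingPath κ ω ∈ Prod.snd '' generatedPairs := by
    filter_upwards [hκt] with ω hω
    obtain ⟨γ, hγ⟩ := hω
    exact ⟨(⟨γ, hγ.continuous⟩, drivingPath κ ω), hγ, rfl⟩
  have hG' : ∀ᵐ w ∂(Process.preWienerMeasure.map (drivingPath κ)),
      w ∈ Prod.snd '' generatedPairs :=
    (ae_map_iff (measurable_drivingPath κ).aemeasurable measurableSet_snd_image_generatedPairs).2 hG
  rw [← hlaw] at hG'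
  -- pull back along `Φ`
  filter_upwards [ae_of_ae_map hΦm.aemeasurable hG'] with ω hω
  obtain ⟨⟨γ, W⟩, hA, hW⟩ := hω
  refine ⟨γ, ?_⟩
  have hWΦ : W = Φ ω := hW
  have hW' : (W : ℝ≥0 → ℝ) = fun t ↦ Real.sqrt κ * B' t ω := by
    rw [hWΦ, hΦdef]
    rfl
  rw [← hW']
  exact hA

/-- **The SLE_κ trace theorem for every Brownian motion, from its canonical-space form** — variant
quantified in the binder shape of the chordal input of the whole-plane pipeline
(`IsWholePlaneSLEKappaRho.exists_of_chordal_eight`): every probability space `(Ω', P')` in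
`Type`, every `IsBrownianReal B' P'` with measurable marginals and continuous paths.
Lawler (2005), §6.1. [cite: Lawler2005, §6.1] -/
theorem HasSLETrace.ae_exists_isGeneratedByCurve' {κ : ℝ≥0} (hκt : HasSLETrace κ) :
    ∀ (Ω' : Type) [MeasurableSpace Ω'] (P' : Measure Ω') [IsProbabilityMeasure P']
      (B' : ℝ≥0 → Ω' → ℝ), IsBrownianReal B' P' → (∀ t, Measurable (B' t)) →
      (∀ ω, Continuous (B' · ω)) →
      ∀ᵐ ω ∂P', ∃ γ : ℝ≥0 → ℂ, Loewner.IsGeneratedByCurve (fun s ↦ Real.sqrt κ * B' s ω) γ :=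
  fun _ _ _ _ _ hB' hm hc ↦ hκt.ae_exists_isGeneratedByCurve hB' hm hc

/-- **The canonical and the general-Brownian-motion forms of the SLE_κ trace theorem are
equivalent**: `HasSLETrace κ` holds iff for every Brownian motion `B'` with measurable marginals
and continuous paths on every probability space (in `Type`), almost surely the chain driven by
`√κ B'` is generated by a curve (`→`: `HasSLETrace.ae_exists_isGeneratedByCurve'`; `←`: the
canonical Brownian motion `Process.brownian` is such a `B'`, `isBrownianReal_brownian'`, and
`sleDriving κ ω t = √κ · brownian t ω` by definition). Lawler (2005), §6.1. [cite: Lawler2005, §6.1] -/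
theorem hasSLETrace_iff_forall_isBrownianReal {κ : ℝ≥0} :
    HasSLETrace κ ↔
      ∀ (Ω' : Type) [MeasurableSpace Ω'] (P' : Measure Ω') [IsProbabilityMeasure P']
        (B' : ℝ≥0 → Ω' → ℝ), IsBrownianReal B' P' → (∀ t, Measurable (B' t)) →
        (∀ ω, Continuous (B' · ω)) →
        ∀ᵐ ω ∂P', ∃ γ : ℝ≥0 → ℂ, Loewner.IsGeneratedByCurve (fun s ↦ Real.sqrt κ * B' s ω) γ := by
  refine ⟨HasSLETrace.ae_exists_isGeneratedByCurve', fun h ↦ ?_⟩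
  haveI : IsProbabilityMeasure Process.preWienerMeasure := isProbabilityMeasure_preWienerMeasure'
  exact h (ℝ≥0 → ℝ) Process.preWienerMeasure Process.brownian isBrownianReal_brownian'
    Process.measurable_brownian Process.continuous_brownian

/-! ### The named fact from `hasSLETrace_eight` -/

/-- **Whole-plane SLE_κ(ρ) from `0` to `∞` exists for every `0 < κ ≤ 2(ρ + 2)`, given
Lawler–Schramm–Werner's SLE₈ trace theorem on the canonical space** (`hasSLETrace_eight`): the
named fact `IsWholePlaneSLEKappaRho.exists` (Miller–Sheffield (2013), Prop. 2.5 with Prop. 2.1)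
follows, `κ ≠ 8` being unconditional (`IsWholePlaneSLEKappaRho.exists_ne_eight`) and `κ = 8`
being `IsWholePlaneSLEKappaRho.exists_of_chordal_eight` fed with the transport
`HasSLETrace.ae_exists_isGeneratedByCurve'`. [cite: MillerSheffield2013, Prop. 2.5] -/
theorem IsWholePlaneSLEKappaRho.exists_of_hasSLETrace_eight (h8 : hasSLETrace_eight) :
    IsWholePlaneSLEKappaRho.exists :=
  IsWholePlaneSLEKappaRho.exists_of_chordal_eight
    (HasSLETrace.ae_exists_isGeneratedByCurve' (κ := 8) h8)

end Literature.Probability.RandomPlanarGeometry
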